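import Literature.IUT.HodgeTheaters.GlobalFrobenioidsRealifyRlfEquiv
import Literature.IUT.LogThetaLattice.GlobalRealifiedLGPFrobenioids
import HarnessLib

/-!
# [IUTchI] Ex 3.5 (i) "`Prime(Φ_{𝒞⊩_mod}) ⥲ V_mod`": THE isomorphism `Φ(L)^rlf ≃ Φ_{𝒞⊩_mod}` respects the two
# primes ↔ places dictionaries of the tree (PROOF-ONLY)

Mochizuki, *Inter-universal Teichmüller theory I*, §3, Example 3.5 (i), kurims manuscript (May 2020) p. 84
([IUTchI] Ex 3.5 (i) p.84) [claim: Mochizuki2012, status: disputed]: "the divisor monoid `Φ_{𝒞⊩_mod}` … may be thought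
of as a single abstract monoid, whose set of primes, which we denote `Prime(𝒞⊩_mod)`, is in natural bijective
correspondence with `V_mod` [cf. the discussion of [FrdI], Example 6.3]"; Mochizuki, *The geometry of Frobenioids I*,
Def 2.4 (i) p. 48 (`Prime(M^rlf) ≅ Prime(M^pf)`) and Ex 6.3 p. 113 (`Prime(Φ(L)) ≃ V(L)`) [cite: MochizukiFrdI2008, Ex. 6.3 p.113].

PROOF-ONLY (no `def`, no instance; abc-iut-w4-d073 gen 4).  The tree has TWO primes ↔ places dictionaries for the two
avatars of `Φ_{𝒞⊩_mod}`: abc-iut-L1's `IsPerfFactorial.Rlf.primeOf : Prime(Φ(L)^pf) → Prime(Φ(L)^rlf)` composed with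
`v ↦ [ι δ_v]` (`EffArithDivisor.pfPrimeOf_bijective`, `RlfPrimes.lean`), and abc-iut-w4-d013's
`FinsuppNNReal.primesEquiv : Prime(V(L) →₀ ℝ_{≥0}) ≃ V(L)` (the class of a primary finitely supported function ↦ its
support point; used for `Φ_{𝒞⊩_mod}` in `GlobalRealifiedFrobenioidsPrimes.lean`).  THIS FILE: every monoid isomorphism
`Ψ : Φ(L)^rlf ≃* Φ_{𝒞⊩_mod}` compatible with `realifyMod` along `ι` (there is exactly one,
`EffArithDivisor.exists_rlfEquiv_realifyMod` / `existsUnique_rlfHom_realifyMod`) carries the prime of `Φ(L)^rlf` at the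
place `v` to the prime of `Φ_{𝒞⊩_mod}` at `v`:
* `EffArithDivisor.primeOf_pfPrimeOf_eq_mk_iota_single` — the prime of `Φ(L)^rlf` at `v` is the class of `ι(δ_v)`;
* `EffArithDivisor.primesEquiv_congr_rlfEquiv_primeOf` — `primesEquiv (Prime.congr Ψ (prime at v)) = v`;
* `EffArithDivisor.congr_rlfEquiv_primeOf_eq_mk_single` — equivalently `Prime.congr Ψ (prime at v) = [1_v]`, the class of
  the unit vector (abc-iut-L5-t2's `logMod v` at `F_mod`).
No new Prop fact; no statement of the paper is strengthened; no side is taken on [IUTchIII] Cor. 3.12.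
-/

noncomputable section

open scoped Classical NNReal

namespace Literature.IUT.HodgeTheaters

open Function NumberField Literature.AlgebraicGeometry.Frobenioids Literature.AnabelianGeometry.EtaleTheta
  Literature.IUT.LogThetaLattice

variable (L : Type) [Field L] [NumberField L]

/-- **The prime of `Φ(L)^rlf` at the place `v` is the class of `ι(δ_v)`**: `ι(δ_v)` is supported exactly at `𝔮_v`
(`EffArithDivisor.supp_iota_single`), hence lies in abc-iut-L1's prime `primeOf 𝔮_v` (`mem_carrier_primeOf_iff`).
([IUTchI] Ex 3.5 (i) p.84) [claim: Mochizuki2012, status: disputed] -/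
theorem EffArithDivisor.primeOf_pfPrimeOf_eq_mk_iota_single (v : Places L) :
    ∃ h : IsPrimary ((EffArithDivisor.isPerfFactorial L).toRealification
        (Perfection.of _ (Multiplicative.ofAdd (EffArithDivisor.single L v)))),
      IsPerfFactorial.Rlf.primeOf (EffArithDivisor.isPerfFactorial L)
          (Quotient.mk (primarySetoid _) ⟨_, EffArithDivisor.isPrimary_of_single L v⟩) =
        Quotient.mk (primarySetoid _) ⟨_, h⟩ := by
  have hmem := (IsPerfFactorial.Rlf.mem_carrier_primeOf_iff (EffArithDivisor.isPerfFactorial L)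
    (Quotient.mk (primarySetoid _) ⟨_, EffArithDivisor.isPrimary_of_single L v⟩)
    ((EffArithDivisor.isPerfFactorial L).toRealification
      (Perfection.of _ (Multiplicative.ofAdd (EffArithDivisor.single L v))))).mpr
    (EffArithDivisor.supp_iota_single L v)
  obtain ⟨hprim, hcls⟩ := hmem
  exact ⟨hprim, hcls.symm⟩

/-- `realifyMod(δ_v)` is a NONZERO multiple of the unit vector at `v` (`1` at archimedean, `e_v⁻¹` at finite `v`).
([IUTchI] Ex 3.5 (i) p.84) [claim: Mochizuki2012, status: disputed] -/
theorem EffArithDivisor.realifyMod_single_eq_single (v : Places L) :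
    ∃ k : ℝ≥0, k ≠ 0 ∧ EffArithDivisor.realifyMod L (EffArithDivisor.single L v) = @Finsupp.single (Val L) ℝ≥0 _ v k := by
  rcases v with w | u
  · refine ⟨1, one_ne_zero, ?_⟩
    rw [EffArithDivisor.single_inl_eq, realifyMod_arch_single]
  · exact ⟨_, inv_ne_zero (absRamIdx_cast_ne_zero L u), realifyMod_single_one L u⟩

/-- **`Ψ` carries the prime of `Φ(L)^rlf` at `v` to the class of the unit vector `1_v`** (for every `Ψ : Φ(L)^rlf ≃* Φ_{𝒞⊩_mod}`
compatible with `realifyMod` along `ι`): `Ψ(ι δ_v) = realifyMod(δ_v)` is a nonzero multiple of `1_v`, hence `≼`-equivalent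
to it. ([IUTchI] Ex 3.5 (i) p.84) [claim: Mochizuki2012, status: disputed] -/
theorem EffArithDivisor.congr_rlfEquiv_primeOf_eq_mk_single
    (Ψ : (EffArithDivisor.isPerfFactorial L).Rlf ≃* Multiplicative (Val L →₀ ℝ≥0))
    (hΨ : ∀ a : EffArithDivisor L,
      Ψ ((EffArithDivisor.isPerfFactorial L).toRealification (Perfection.of _ (Multiplicative.ofAdd a))) =
        Multiplicative.ofAdd (EffArithDivisor.realifyMod L a))
    (v : Places L) :
    Primes.congr Ψ (IsPerfFactorial.Rlf.primeOf (EffArithDivisor.isPerfFactorial L)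
        (Quotient.mk (primarySetoid _) ⟨_, EffArithDivisor.isPrimary_of_single L v⟩)) =
      Quotient.mk (primarySetoid _)
        ⟨Multiplicative.ofAdd (@Finsupp.single (Val L) ℝ≥0 _ v 1), FinsuppNNReal.isPrimary_single v⟩ := by
  obtain ⟨hprim, hcls⟩ := EffArithDivisor.primeOf_pfPrimeOf_eq_mk_iota_single L v
  obtain ⟨k, hk, hreal⟩ := EffArithDivisor.realifyMod_single_eq_single L v
  rw [hcls, Primes.congr_mk Ψ _ hprim (hprim.map_mulEquiv Ψ)]
  apply Quotient.sound
  change Ψ _ ≼ Multiplicative.ofAdd (Finsupp.single v (1 : ℝ≥0))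
  rw [hΨ, hreal, FinsuppNNReal.precsim_iff_support_subset, Finsupp.support_single _ hk,
    Finsupp.support_single _ one_ne_zero]

/-- **[IUTchI] Ex 3.5 (i) "`Prime(Φ_{𝒞⊩_mod}) ⥲ V_mod`", compatibility of the identification**: for every
`Ψ : Φ(L)^rlf ≃* Φ_{𝒞⊩_mod}` compatible with `realifyMod`, abc-iut-w4-d013's dictionary `FinsuppNNReal.primesEquiv` sends
`Ψ`(the prime of `Φ(L)^rlf` at `v`) to `v` — the L1 dictionary (`[FrdI] Def 2.4 (i) / Ex 6.3`) and the L5/L6 dictionary agree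
through `Ψ`. ([IUTchI] Ex 3.5 (i) p.84) [claim: Mochizuki2012, status: disputed] -/
theorem EffArithDivisor.primesEquiv_congr_rlfEquiv_primeOf
    (Ψ : (EffArithDivisor.isPerfFactorial L).Rlf ≃* Multiplicative (Val L →₀ ℝ≥0))
    (hΨ : ∀ a : EffArithDivisor L,
      Ψ ((EffArithDivisor.isPerfFactorial L).toRealification (Perfection.of _ (Multiplicative.ofAdd a))) =
        Multiplicative.ofAdd (EffArithDivisor.realifyMod L a))
    (v : Places L) :
    FinsuppNNReal.primesEquiv (Primes.congr Ψ (IsPerfFactorial.Rlf.primeOf (EffArithDivisor.isPerfFactorial L)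
        (Quotient.mk (primarySetoid _) ⟨_, EffArithDivisor.isPrimary_of_single L v⟩))) = v := by
  rw [EffArithDivisor.congr_rlfEquiv_primeOf_eq_mk_single L Ψ hΨ v]
  exact FinsuppNNReal.primesEquiv_mk_single v

/-- The composite dictionary `V(L) → Prime(Φ(L)^pf) → Prime(Φ(L)^rlf) → Prime(Φ_{𝒞⊩_mod}) → V(L)` is the identity, for THE
(unique) `Ψ` of `EffArithDivisor.exists_rlfEquiv_realifyMod`. ([IUTchI] Ex 3.5 (i) p.84) [claim: Mochizuki2012, status: disputed] -/
theorem EffArithDivisor.exists_rlfEquiv_primes_compat :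
    ∃ Ψ : (EffArithDivisor.isPerfFactorial L).Rlf ≃* Multiplicative (Val L →₀ ℝ≥0),
      (∀ a : EffArithDivisor L,
          Ψ ((EffArithDivisor.isPerfFactorial L).toRealification (Perfection.of _ (Multiplicative.ofAdd a))) =
            Multiplicative.ofAdd (EffArithDivisor.realifyMod L a)) ∧
        ∀ v : Places L,
          FinsuppNNReal.primesEquiv (Primes.congr Ψ (IsPerfFactorial.Rlf.primeOf (EffArithDivisor.isPerfFactorial L)
            (Quotient.mk (primarySetoid _) ⟨_, EffArithDivisor.isPrimary_of_single L v⟩))) = v := by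
  obtain ⟨Ψ, hΨ⟩ := EffArithDivisor.exists_rlfEquiv_realifyMod L
  exact ⟨Ψ, hΨ, EffArithDivisor.primesEquiv_congr_rlfEquiv_primeOf L Ψ hΨ⟩

end Literature.IUT.HodgeTheaters

end
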